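import Mathlib
import Summits.Ventures.HodgeRepro0.P5S4TransportBasic
import Summits.Ventures.HodgeRepro0.P5S4Transport

/-!
# P5SimpleWeilRow — the k-Weil row of the simple eightfold on the generic class, kernel-checked
(P5-Dim8Census-v4 §2.5 (a), Theorem 3.1c (b); cell pub-hodge-repro0, seat p5)

The configuration of the generic CM field of degree 16 (block structure (8), T̄ = S₈, the split extension):
points `S = Fin 8 × Bool` (pair `j`, point `e`), `ι (j, e) = (j, ¬e)`, `T = {lift σ} ∪ {ι * lift σ : σ ∈ S₈}` with
`lift σ (j, e) = (σ j, e)` (the sign-free lifts; `|T| = 80640`), and a CM type `Φ e = {(j, e j)}` of SIGNATURE (4, 4)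
(`Weil e`: exactly four `j` with `e j = false`). With `Δ := {(j, false)}` (one point of each pair) the file certifies,
in the vocabulary of `P5S4Transport` (Def 1.1 of P5-LowDimCensus):

* `card_T`: `|T| = 80640`; `iota_mem_T`; `T` is closed under multiplication (`mul_mem_T`) and inverses
  (`inv_mem_T`) — it is the group of the census's T class (the split extension C₂ × S₈);
* `balanced_Δ`: `Δ` is a balanced `8`-set (`p = 4`) for `(T, Φ e)` whenever `Weil e`;
* `primitive_Δ`: it is primitive (no proper nonempty balanced subset);
* `orbit_Δ` / `card_orbit_Δ`: its orbit is `{Δ, ιΔ}`, of size `2`;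
* `stab_Δ` / `card_stab_Δ`: its stabiliser is exactly the set of sign-free lifts, of size `40320 = |S₈|`;
* `iota_not_mem_stab_Δ`: `ι ∉ Stab(Δ)`;
* `not_balanced_of_not_weil`: if `e` is NOT of signature (4, 4), `Δ` is not balanced for `(T, Φ e)`.

So the row `(p; |O|; ·; H-partition) = (4; 2; ·; [8])` of the generic class is a theorem: the (4,4) type carries
the Weil-class orbit `{Δ, ιΔ}` with `Stab(Δ) = the S₈ factor` (so `[T : Stab] = 2`, the orbit field being the
imaginary quadratic field fixed by the sign-free lifts). NOT certified: the multiset stabiliser `H_Δ` (equal to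
`Stab(Δ)` by the engine's reading), the other 40 classes carrying the row, the nondegeneracy of the other signatures
(a = 1, 2, 3 carry no exceptional orbit — a census fact), and anything about the census figures.
-/

namespace HodgeRepro0.P5SimpleWeilRow

open Finset HodgeRepro0.P5S4Transport

/-- the 16 points: pair `j ∈ Fin 8`, point `e ∈ Bool` (`false` = the "0" point, `true` = its conjugate) -/
abbrev S := Fin 8 × Bool

/-- an element of the group: `(σ, b) ↦ ((j, e) ↦ (σ j, e xor b))` — the sign-free lift of `σ`, composed with the
conjugation `ι` iff `b` -/
def elt (p : Equiv.Perm (Fin 8) × Bool) : Equiv.Perm S :=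
  Equiv.prodCongr p.1 (if p.2 then ⟨not, not, Bool.not_not, Bool.not_not⟩ else Equiv.refl Bool)

/-- the value of `elt (σ, b)` on a point -/
theorem elt_apply (σ : Equiv.Perm (Fin 8)) (b : Bool) (j : Fin 8) (e : Bool) :
    elt (σ, b) (j, e) = (σ j, if b then !e else e) := by
  unfold elt
  cases b <;> rfl

/-- complex conjugation: swap the two points of every pair -/
def ι : Equiv.Perm S := elt (1, true)

/-- `ι (j, e) = (j, !e)` -/
theorem ι_apply (j : Fin 8) (e : Bool) : ι (j, e) = (j, !e) := by
  unfold ι; rw [elt_apply]; rfl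

/-- the product of two elements -/
theorem elt_mul (σ τ : Equiv.Perm (Fin 8)) (b c : Bool) : elt (σ, b) * elt (τ, c) = elt (σ * τ, xor b c) := by
  apply Equiv.ext
  rintro ⟨j, e⟩
  rw [Equiv.Perm.mul_apply, elt_apply, elt_apply, elt_apply, Equiv.Perm.mul_apply]
  cases b <;> cases c <;> cases e <;> rfl

/-- the identity -/
theorem elt_one : elt (1, false) = 1 := by
  apply Equiv.ext
  rintro ⟨j, e⟩
  rw [elt_apply]; rfl

/-- inverses -/
theorem elt_inv (σ : Equiv.Perm (Fin 8)) (b : Bool) : (elt (σ, b))⁻¹ = elt (σ⁻¹, b) := by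
  apply inv_eq_of_mul_eq_one_right
  rw [elt_mul, mul_inv_cancel, Bool.xor_self, elt_one]

/-- `elt` is injective -/
theorem elt_injective : Function.Injective elt := by
  rintro ⟨σ, b⟩ ⟨τ, c⟩ h
  have h0 := congrArg (fun p : Equiv.Perm S => p (0, false)) h
  simp only [elt_apply] at h0
  have hb : b = c := by
    have := congrArg Prod.snd h0
    cases b <;> cases c <;> simp at this ⊢
  subst hb
  have hσ : σ = τ := by
    apply Equiv.ext
    intro j
    have := congrArg (fun p : Equiv.Perm S => (p (j, false)).1) h
    simpa only [elt_apply] using this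
  rw [hσ]

/-- THE GROUP T of the generic class: all `lift σ` and `ι * lift σ` (irreducible: its enumeration has 80640
elements and must never be unfolded by `whnf`) -/
@[irreducible] def T : Finset (Equiv.Perm S) := (Finset.univ : Finset (Equiv.Perm (Fin 8) × Bool)).image elt

/-- membership in `T` -/
theorem mem_T {t : Equiv.Perm S} : t ∈ T ↔ ∃ σ b, elt (σ, b) = t := by
  unfold T
  simp only [Finset.mem_image, Finset.mem_univ, true_and, Prod.exists]

/-- `|T| = 2 · 8! = 80640` -/
theorem card_T : T.card = 80640 := by
  unfold T
  rw [Finset.card_image_of_injective _ elt_injective, Finset.card_univ, Fintype.card_prod, Fintype.card_perm,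
    Fintype.card_fin, Fintype.card_bool]
  rfl

/-- `ι ∈ T` -/
theorem iota_mem_T : ι ∈ T := mem_T.2 ⟨1, true, rfl⟩

/-- `T` is closed under multiplication -/
theorem mul_mem_T {s t : Equiv.Perm S} (hs : s ∈ T) (ht : t ∈ T) : s * t ∈ T := by
  obtain ⟨σ, b, rfl⟩ := mem_T.1 hs
  obtain ⟨τ, c, rfl⟩ := mem_T.1 ht
  exact mem_T.2 ⟨σ * τ, xor b c, (elt_mul σ τ b c).symm⟩

/-- `T` contains the inverses -/
theorem inv_mem_T {t : Equiv.Perm S} (ht : t ∈ T) : t⁻¹ ∈ T := by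
  obtain ⟨σ, b, rfl⟩ := mem_T.1 ht
  exact mem_T.2 ⟨σ⁻¹, b, (elt_inv σ b).symm⟩

/-- the eight points with second coordinate `b` -/
def pts (b : Bool) : Finset S := Finset.univ.image (fun j : Fin 8 => (j, b))

/-- membership in `pts b` -/
theorem mem_pts {b : Bool} {x : S} : x ∈ pts b ↔ x.2 = b := by
  unfold pts
  rw [Finset.mem_image]
  constructor
  · rintro ⟨j, -, rfl⟩; rfl
  · intro h; exact ⟨x.1, Finset.mem_univ _, Prod.ext rfl h.symm⟩

/-- `|pts b| = 8` -/
theorem card_pts (b : Bool) : (pts b).card = 8 := by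
  unfold pts
  rw [Finset.card_image_of_injective _ (fun j k h => (Prod.mk.inj h).1), Finset.card_univ, Fintype.card_fin]

/-- the set `Δ` = the eight points `(j, false)` -/
def Δ : Finset S := pts false

/-- the image of `pts b` under `elt (σ, c)` is `pts (c xor b)` -/
theorem smulF_elt_pts (σ : Equiv.Perm (Fin 8)) (c b : Bool) : smulF (elt (σ, c)) (pts b) = pts (xor c b) := by
  ext ⟨j, f⟩
  rw [mem_smulF, mem_pts, mem_pts, elt_inv, elt_apply]
  cases c <;> cases b <;> cases f <;> simp

/-- the CM type attached to a choice `e : Fin 8 → Bool` -/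
def Φ (e : Fin 8 → Bool) : Finset S := Finset.univ.image (fun j => (j, e j))

/-- signature (4, 4): exactly four pairs choose the point `false` -/
def Weil (e : Fin 8 → Bool) : Prop := (Finset.univ.filter (fun j => e j = false)).card = 4

/-- `#false + #true = 8` -/
theorem card_false_add_card_true (e : Fin 8 → Bool) :
    (Finset.univ.filter (fun j => e j = false)).card + (Finset.univ.filter (fun j => e j = true)).card = 8 := by
  have h := Finset.card_filter_add_card_filter_not (s := (Finset.univ : Finset (Fin 8))) (p := fun j => e j = false)
  have h2 : (Finset.univ.filter (fun j => ¬ e j = false)) = Finset.univ.filter (fun j => e j = true) := by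
    ext j; simp
  rw [h2] at h
  rw [h]
  simp

/-- the points of `A × {b}` lying in `Φ e` are those `(j, b)` with `j ∈ A` and `e j = b` -/
theorem image_inter_Φ (e : Fin 8 → Bool) (A : Finset (Fin 8)) (b : Bool) :
    A.image (fun j => (j, b)) ∩ Φ e = (A.filter (fun j => e j = b)).image (fun j => (j, b)) := by
  ext ⟨j, f⟩
  simp only [Finset.mem_inter, Finset.mem_image, Finset.mem_filter, Φ, Finset.mem_univ, true_and]
  constructor
  · rintro ⟨⟨k, hk, hkj⟩, m, hm⟩
    obtain ⟨rfl, rfl⟩ := Prod.mk.inj hkj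
    obtain ⟨rfl, hem⟩ := Prod.mk.inj hm
    exact ⟨m, ⟨hk, hem⟩, rfl⟩
  · rintro ⟨k, ⟨hk, hek⟩, hkj⟩
    obtain ⟨rfl, rfl⟩ := Prod.mk.inj hkj
    exact ⟨⟨k, hk, rfl⟩, k, by rw [hek]⟩

/-- the cardinality of `(A × {b}) ∩ Φ e` -/
theorem card_image_inter_Φ (e : Fin 8 → Bool) (A : Finset (Fin 8)) (b : Bool) :
    (A.image (fun j => (j, b)) ∩ Φ e).card = (A.filter (fun j => e j = b)).card := by
  rw [image_inter_Φ, Finset.card_image_of_injective _ (fun j k h => (Prod.mk.inj h).1)]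

/-- `pts b` is `univ × {b}` -/
theorem pts_eq (b : Bool) : pts b = (Finset.univ : Finset (Fin 8)).image (fun j => (j, b)) := rfl

/-- BALANCED: for a type of signature (4, 4), `|tΔ ∩ Φ| = 4` for every `t ∈ T` -/
theorem balanced_Δ (e : Fin 8 → Bool) (he : Weil e) : Balanced T (Φ e) 4 Δ := by
  refine ⟨card_pts false, ?_⟩
  intro t ht
  obtain ⟨σ, b, rfl⟩ := mem_T.1 ht
  unfold Δ
  rw [smulF_elt_pts, pts_eq, card_image_inter_Φ]
  have h := card_false_add_card_true e
  unfold Weil at he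
  cases b
  · simpa using he
  · simp only [Bool.xor_false]
    omega

/-- a permutation of `Fin 8` carrying a finset onto another of the same cardinality -/
theorem exists_perm_image_eq (A B : Finset (Fin 8)) (h : A.card = B.card) :
    ∃ σ : Equiv.Perm (Fin 8), A.image σ = B := by
  have hc : Fintype.card {x // x ∈ A} = Fintype.card {x // x ∈ B} := by simpa using h
  let e : {x // x ∈ A} ≃ {x // x ∈ B} := Fintype.equivOfCardEq hc
  refine ⟨e.extendSubtype, ?_⟩
  apply Finset.eq_of_subset_of_card_le
  · intro y hy
    rw [Finset.mem_image] at hy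
    obtain ⟨x, hx, rfl⟩ := hy
    rw [Equiv.extendSubtype_apply_of_mem e x hx]
    exact (e ⟨x, hx⟩).2
  · rw [Finset.card_image_of_injective _ e.extendSubtype.injective, h]

/-- a subset of `Δ` is `J × {false}` for `J` = its first coordinates -/
theorem subset_Δ_eq (Δ₁ : Finset S) (h : Δ₁ ⊆ Δ) : Δ₁ = (Δ₁.image Prod.fst).image (fun j => (j, false)) := by
  ext ⟨j, f⟩
  rw [Finset.mem_image]
  constructor
  · intro hx
    have hf : f = false := mem_pts.1 (h hx)
    subst hf
    exact ⟨j, Finset.mem_image_of_mem Prod.fst hx, rfl⟩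
  · rintro ⟨k, hk, hkj⟩
    obtain ⟨rfl, rfl⟩ := Prod.mk.inj hkj
    rw [Finset.mem_image] at hk
    obtain ⟨x, hx, rfl⟩ := hk
    have hf : x.2 = false := mem_pts.1 (h hx)
    have : x = (x.1, false) := Prod.ext rfl hf
    rw [← this]; exact hx

/-- the image of `J × {false}` under a sign-free lift -/
theorem smulF_elt_image (σ : Equiv.Perm (Fin 8)) (J : Finset (Fin 8)) :
    smulF (elt (σ, false)) (J.image (fun j => (j, false))) = (J.image σ).image (fun j => (j, false)) := by
  ext ⟨j, f⟩
  rw [mem_smulF, elt_inv, elt_apply, Finset.mem_image, Finset.mem_image]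
  simp only [Bool.false_eq_true, ↓reduceIte, Finset.mem_image]
  constructor
  · rintro ⟨k, hk, hkj⟩
    obtain ⟨hk1, rfl⟩ := Prod.mk.inj hkj
    refine ⟨j, ⟨k, hk, ?_⟩, rfl⟩
    rw [hk1]; simp
  · rintro ⟨m, ⟨k, hk, rfl⟩, hmj⟩
    obtain ⟨rfl, rfl⟩ := Prod.mk.inj hmj
    exact ⟨k, hk, by simp⟩

/-- PRIMITIVE: no proper nonempty subset of `Δ` is balanced -/
theorem primitive_Δ (e : Fin 8 → Bool) (he : Weil e) : Primitive T (Φ e) 4 Δ := by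
  refine ⟨balanced_Δ e he, ?_⟩
  intro Δ₁ hsub hne q hb
  obtain ⟨hcard, hbal⟩ := hb
  set J : Finset (Fin 8) := Δ₁.image Prod.fst with hJ
  have hΔ₁ : Δ₁ = J.image (fun j => (j, false)) := subset_Δ_eq Δ₁ hsub.1
  have hJcard : J.card = Δ₁.card := by
    conv_rhs => rw [hΔ₁]
    rw [Finset.card_image_of_injective _ (fun j k h => (Prod.mk.inj h).1)]
  set Z : Finset (Fin 8) := Finset.univ.filter (fun j => e j = false) with hZ
  have hZcard : Z.card = 4 := he
  -- for a sign-free lift σ: |lift σ Δ₁ ∩ Φ e| = |σ(J) ∩ Z|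
  have key : ∀ σ : Equiv.Perm (Fin 8), (smulF (elt (σ, false)) Δ₁ ∩ Φ e).card = (J.image σ ∩ Z).card := by
    intro σ
    rw [hΔ₁, smulF_elt_image, card_image_inter_Φ]
    congr 1
    ext j
    simp [hZ]
  have h2q : 2 * q = J.card := by rw [hJcard, hcard]
  have hJle : J.card ≤ 7 := by
    have hle : J.card ≤ 8 := by
      have := Finset.card_le_univ J
      simpa using this
    have hne8 : J.card ≠ 8 := by
      intro h8
      apply hsub.2
      intro x hx
      have hJu : J = Finset.univ := Finset.eq_univ_of_card J (by simpa using h8)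
      rw [hΔ₁, hJu]
      have hf : x.2 = false := mem_pts.1 hx
      rw [Finset.mem_image]
      exact ⟨x.1, Finset.mem_univ _, Prod.ext rfl hf.symm⟩
    omega
  have hq1 : 1 ≤ q := by
    have : 0 < Δ₁.card := Finset.card_pos.2 hne
    omega
  rcases Nat.lt_or_ge J.card 5 with hsmall | hbig
  · -- |J| = 2q ≤ 4: a lift σ with σ(J) ⊆ Z gives |σ(J) ∩ Z| = 2q ≠ q
    obtain ⟨Z', hZ'sub, hZ'card⟩ := Finset.exists_subset_card_eq (s := Z) (n := J.card) (by omega)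
    obtain ⟨σ, hσ⟩ := exists_perm_image_eq J Z' hZ'card.symm
    have := hbal _ (mem_T.2 ⟨σ, false, rfl⟩)
    rw [key, hσ, Finset.inter_eq_left.2 hZ'sub, hZ'card] at this
    omega
  · -- |J| = 6: a lift σ with σ(J) ⊇ Z gives |σ(J) ∩ Z| = 4 ≠ 3
    obtain ⟨J', hJ'sub, hJ'card⟩ := Finset.exists_subset_card_eq (s := J) (n := 4) (by omega)
    obtain ⟨σ, hσ⟩ := exists_perm_image_eq J' Z (by rw [hJ'card, hZcard])
    have hZsub : Z ⊆ J.image σ := by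
      rw [← hσ]; exact Finset.image_subset_image hJ'sub
    have := hbal _ (mem_T.2 ⟨σ, false, rfl⟩)
    rw [key, Finset.inter_eq_right.2 hZsub, hZcard] at this
    omega

/-- `ιΔ` = the eight points `(j, true)` -/
theorem smulF_ι_Δ : smulF ι Δ = pts true := by
  unfold ι Δ
  rw [smulF_elt_pts]; rfl

/-- `ιΔ ≠ Δ` -/
theorem smulF_ι_Δ_ne : smulF ι Δ ≠ Δ := by
  rw [smulF_ι_Δ]
  intro h
  have h1 : ((0 : Fin 8), true) ∈ pts true := mem_pts.2 rfl
  rw [h] at h1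
  have := mem_pts.1 h1
  simp at this

/-- the orbit of `Δ` is `{Δ, ιΔ}` -/
theorem orbit_Δ : orbit T Δ = {Δ, smulF ι Δ} := by
  ext X
  rw [mem_orbit, Finset.mem_insert, Finset.mem_singleton]
  constructor
  · rintro ⟨t, ht, rfl⟩
    obtain ⟨σ, b, rfl⟩ := mem_T.1 ht
    unfold Δ
    rw [smulF_elt_pts]
    cases b
    · left; rfl
    · right
      show pts (xor true false) = smulF ι Δ
      rw [smulF_ι_Δ]; rfl
  · rintro (rfl | rfl)
    · exact ⟨1, mem_T.2 ⟨1, false, elt_one⟩, smulF_one Δ⟩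
    · exact ⟨ι, iota_mem_T, rfl⟩

/-- `|O| = 2` -/
theorem card_orbit_Δ : (orbit T Δ).card = 2 := by
  rw [orbit_Δ]
  exact Finset.card_pair (fun h => smulF_ι_Δ_ne h.symm)

/-- the stabiliser of `Δ` is exactly the set of sign-free lifts -/
theorem stab_Δ : stab T Δ = (Finset.univ : Finset (Equiv.Perm (Fin 8))).image (fun σ => elt (σ, false)) := by
  ext t
  rw [mem_stab, Finset.mem_image]
  constructor
  · rintro ⟨ht, he⟩
    obtain ⟨σ, b, rfl⟩ := mem_T.1 ht
    cases b
    · exact ⟨σ, Finset.mem_univ _, rfl⟩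
    · exfalso
      unfold Δ at he
      rw [smulF_elt_pts] at he
      have h1 : ((0 : Fin 8), true) ∈ pts (xor true false) := mem_pts.2 rfl
      rw [he] at h1
      have := mem_pts.1 h1
      simp at this
  · rintro ⟨σ, -, rfl⟩
    refine ⟨mem_T.2 ⟨σ, false, rfl⟩, ?_⟩
    unfold Δ
    rw [smulF_elt_pts]; rfl

/-- `|Stab(Δ)| = 8! = 40320` -/
theorem card_stab_Δ : (stab T Δ).card = 40320 := by
  rw [stab_Δ, Finset.card_image_of_injective, Finset.card_univ, Fintype.card_perm, Fintype.card_fin]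
  · rfl
  · intro σ τ h
    exact (Prod.mk.inj (elt_injective h)).1

/-- `ι ∉ Stab(Δ)` -/
theorem iota_not_mem_stab_Δ : ι ∉ stab T Δ := by
  rw [mem_stab]
  rintro ⟨-, h⟩
  exact smulF_ι_Δ_ne h

/-- if the signature is not (4, 4), `Δ` is NOT balanced (`Δ` itself meets `Φ e` in `#false ≠ 4` points) -/
theorem not_balanced_of_not_weil (e : Fin 8 → Bool) (he : ¬ Weil e) : ¬ Balanced T (Φ e) 4 Δ := by
  rintro ⟨-, h⟩
  have := h _ (mem_T.2 ⟨1, false, rfl⟩)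
  unfold Δ at this
  rw [smulF_elt_pts, pts_eq, card_image_inter_Φ] at this
  exact he this

end HodgeRepro0.P5SimpleWeilRow
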